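import Literature.RingTheory.TightClosure.FRationalNormal
import Mathlib.RingTheory.KrullDimension.Basic
import HarnessLib

/-!
# Partial parameter ideals of an F-rational local ring are tightly closed

Let `(R, 𝔪)` be a Noetherian local ring of prime characteristic `p` which is F-rational in the sense
of Fedder–Watanabe (the tree's `Literature.RingTheory.TightClosure.IsFRational`: every ideal generated
by a FULL system of parameters is tightly closed), and let `s = (s₀, …, s_{d-1})` be a system of
parameters.  We prove that every ideal `(s_j : j < i)` generated by an initial segment of `s` is
tightly closed (the step of [HochsterHuneke1994, Thm. 4.2 (c)] "F-rational ⇒ Cohen–Macaulay" that,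
combined with colon capturing `((s_{<i}) : s_i) ⊆ (s_{<i})^*`, makes `s` a regular sequence).

Proof.  Put `I = (s_j : j < i)`.  For `n ≥ 1` the tuple `s⁽ⁿ⁾` with `s⁽ⁿ⁾_j = s_j` for `j < i` and
`s⁽ⁿ⁾_j = s_jⁿ` for `j ≥ i` is again a system of parameters (same radical), so `J_n = (s⁽ⁿ⁾)` is
tightly closed and `I^* ⊆ J_n^* = J_n ⊆ I + 𝔪ⁿ`.  Hence `I^* ⊆ ⋂ₙ (I + 𝔪ⁿ) = I` by Krull's
intersection theorem in the Noetherian local ring `R/I` — verbatim the argument of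
`IsFRational.isTightlyClosed_span_singleton` (the case of a principal ideal `(x)`), generalised from
one parameter to an initial segment.
-/

-- single-problem summit: the doubled namespace component is forced
set_option linter.dupNamespace false

noncomputable section

open Literature.RingTheory.TightClosure IsLocalRing

namespace Summit.ResolutionOfSingularities.ResolutionOfSingularities.Theorems.FRationalResolution

/-- **Partial parameter ideals of an F-rational local ring are tightly closed.**  If `(R, 𝔪)` is a
Noetherian local ring of prime characteristic `p` in which every ideal generated by a system of
parameters is tightly closed, then for every system of parameters `s : Fin d → R` and every `i`, the
ideal `(s_j : j < i)` is tightly closed: `(s_{<i})^* ⊆ ⋂ₙ (s_{<i}, s_{≥ i}ⁿ) ⊆ ⋂ₙ ((s_{<i}) + 𝔪ⁿ)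
= (s_{<i})` by Krull's intersection theorem in `R/(s_{<i})`.
[cite: HochsterHuneke1994, Thm. 4.2 (c) (proof)] -/
theorem isTightlyClosed_span_image_Iio_of_isFRational (p : ℕ) [Fact p.Prime] (R : Type) [CommRing R]
    [IsLocalRing R] [IsNoetherianRing R] [CharP R p] (hR : IsFRational R p) {d : ℕ} (s : Fin d → R)
    (hs : IsSystemOfParameters s) (i : Fin d) : IsTightlyClosed p (Ideal.span (s '' Set.Iio i)) := by
  classical
  obtain ⟨hd, hrad⟩ := hs
  -- every parameter lies in `𝔪 = rad (s)`
  have hsm : ∀ j, s j ∈ maximalIdeal R := fun j => by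
    rw [← hrad]
    exact Ideal.le_radical (Ideal.subset_span ⟨j, rfl⟩)
  set I : Ideal R := Ideal.span (s '' Set.Iio i) with hI
  have hIm : I ≤ maximalIdeal R := by
    refine Ideal.span_le.mpr ?_
    rintro _ ⟨j, -, rfl⟩
    exact hsm j
  rw [isTightlyClosed_iff_le]
  intro y hy
  -- `y ∈ I + 𝔪ⁿ` for every `n ≥ 1`, via the system of parameters `s_{<i}, s_{≥ i}ⁿ`
  have hyn : ∀ n : ℕ, 0 < n → y ∈ I ⊔ maximalIdeal R ^ n := by
    intro n hn
    -- the modified system of parameters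
    let s' : Fin d → R := fun j => if j < i then s j else s j ^ n
    have hs'_lt : ∀ {j}, j < i → s' j = s j := fun hj => if_pos hj
    have hs'_ge : ∀ {j}, ¬ j < i → s' j = s j ^ n := fun hj => if_neg hj
    set J : Ideal R := Ideal.span (Set.range s') with hJ
    have hsop : IsSystemOfParameters s' := by
      refine ⟨hd, le_antisymm ?_ ?_⟩
      · -- `rad J ≤ 𝔪` since `J ≤ 𝔪`
        refine (maximalIdeal.isMaximal R).isPrime.radical_le_iff.mpr (Ideal.span_le.mpr ?_)
        rintro _ ⟨j, rfl⟩
        by_cases hj : j < i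
        · rw [hs'_lt hj]
          exact hsm j
        · rw [hs'_ge hj]
          exact Ideal.pow_mem_of_mem _ (hsm j) n hn
      · -- `𝔪 = rad (s) ≤ rad J` since `(s) ≤ rad J`
        rw [← hrad]
        refine Ideal.radical_le_radical_iff.mpr (Ideal.span_le.mpr ?_)
        rintro _ ⟨j, rfl⟩
        by_cases hj : j < i
        · exact Ideal.le_radical (Ideal.subset_span ⟨j, hs'_lt hj⟩)
        · exact ⟨n, Ideal.subset_span ⟨j, hs'_ge hj⟩⟩
    have hJ' : IsTightlyClosed p J := hR s' hsop
    have hIJ : I ≤ J := by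
      refine Ideal.span_le.mpr ?_
      rintro _ ⟨j, hj, rfl⟩
      exact Ideal.subset_span ⟨j, hs'_lt hj⟩
    have hyJ : y ∈ J := hJ'.le (tightClosure_mono p hIJ hy)
    refine (Ideal.span_le.mpr ?_ : J ≤ I ⊔ maximalIdeal R ^ n) hyJ
    rintro _ ⟨j, rfl⟩
    by_cases hj : j < i
    · rw [hs'_lt hj]
      exact Ideal.mem_sup_left (Ideal.subset_span ⟨j, hj, rfl⟩)
    · rw [hs'_ge hj]
      exact Ideal.mem_sup_right (Ideal.pow_mem_pow (hsm j) n)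
  -- Krull's intersection theorem in `R/I`
  have hItop : I ≠ ⊤ := fun h => (maximalIdeal.isMaximal R).ne_top (top_le_iff.mp (h ▸ hIm))
  haveI : Nontrivial (R ⧸ I) := Ideal.Quotient.nontrivial_iff.mpr hItop
  haveI : IsLocalRing (R ⧸ I) :=
    IsLocalRing.of_surjective' (Ideal.Quotient.mk I) Ideal.Quotient.mk_surjective
  have hmk : (maximalIdeal R).map (Ideal.Quotient.mk I) = maximalIdeal (R ⧸ I) :=
    IsLocalRing.map_maximalIdeal_of_surjective _ Ideal.Quotient.mk_surjective
  have hbar : Ideal.Quotient.mk I y ∈ ⨅ n : ℕ, maximalIdeal (R ⧸ I) ^ n := by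
    refine Ideal.mem_iInf.mpr fun n => ?_
    rcases Nat.eq_zero_or_pos n with rfl | hn
    · rw [pow_zero, Ideal.one_eq_top]
      trivial
    have := Ideal.mem_map_of_mem (Ideal.Quotient.mk I) (hyn n hn)
    rw [Ideal.map_sup, Ideal.map_quotient_self, bot_sup_eq, Ideal.map_pow, hmk] at this
    exact this
  rw [Ideal.iInf_pow_eq_bot_of_isLocalRing _ (maximalIdeal.isMaximal (R ⧸ I)).ne_top,
    Ideal.mem_bot, Ideal.Quotient.eq_zero_iff_mem] at hbar
  exact hbar

end Summit.ResolutionOfSingularities.ResolutionOfSingularities.Theorems.FRationalResolution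

end
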